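import Summits.CriticalPhenomena.Ising3DConformalLimit.Theses.EnergyNotSigmaSquared
import Summits.CriticalPhenomena.Ising3DConformalLimit.Theorems.GapForcesFarMerging.Negative.IsingCertificate
import Summits.CriticalPhenomena.Ising3DConformalLimit.Theorems.MoebiusLimitExists.Negative.FreePermutations
import Literature.Probability.LatticeModels.SourcedDoubleCurrentsSwitchingProofs
import Literature.Probability.LatticeModels.HighDimPointwiseTriviality

/-!
# Energy factorisation of the critical pair covariance via sourced double currents
(line `rp-unpinch-single-passage` of crux `GapForcesFarMerging`, item stmt-CriticalPhenomena-4468;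
stub `energyFactorisation_criticalCorr`)

For the nearest-neighbour Ising model on `ℤ³` at `β_c` (plus state = free state), the truncated
four-point function `⟨σ_aσ_b ; σ_xσ_y⟩ = ⟨σ_aσ_bσ_xσ_y⟩ - ⟨σ_aσ_b⟩⟨σ_xσ_y⟩` factorises over the two
"cross" pairings as
`G(a,x)G(b,y)·P^{ax,by}_{β_c}[a ↮ b] + G(a,y)G(b,x)·P^{ay,bx}_{β_c}[a ↮ b]`,
where `P^{A,B}_{β_c} = sourcedDoubleCurrentLawInf 3 (criticalBeta 3) A B` is the infinite-volume
sourced double random-current measure. This is Aizenman's identity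
`U₄ = -2 G G · P[a ↔ b]` (ADC21 (3.11), the tree theorem
`freeUrsellFour_eq_sourcedDoubleCurrent_holds` in its `criticalCorr` spelling
`freeUrsellFour_eq_sourcedDoubleCurrent.criticalCorr_eq`) averaged over the two labellings
`(a,x | b,y)` and `(a,y | b,x)`, using the relabelling symmetry of the four-point monomial
(`criticalCorr_comp_perm`) and of the pair correlator (`criticalCorr_two_pair_comm`).

## References

* M. Aizenman, H. Duminil-Copin, Ann. Math. 194 (2021), eq. (3.11) [AizenmanDuminilCopinAnnals2021].
* M. Aizenman, Comm. Math. Phys. 86 (1982) 1–48, Prop. 5.2.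
-/

noncomputable section

namespace Summit.CriticalPhenomena.Ising3DConformalLimit.EnergyNotSigmaSquaredGapForcesFarMerging

open scoped symmDiff
open MeasureTheory
open Literature.Probability.LatticeModels Literature.Probability.Percolation
open Summit.CriticalPhenomena.Ising3DConformalLimit.Theses.EnergyNotSigmaSquared
open Summit.CriticalPhenomena.Ising3DConformalLimit.Theorems.GapForcesFarMerging.Negative
  (e₁ e₂ cc2 FarMergingShape criticalCorr_comp_perm)

/-- Transposition `(1 2)` of the arguments of the critical four-point function. [folklore] -/
theorem criticalCorr_four_swap12 (a b c d : Site 3) :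
    criticalCorr 3 4 ![a, c, b, d] = criticalCorr 3 4 ![a, b, c, d] := by
  have h : (![a, b, c, d] : Fin 4 → Site 3) ∘ ⇑(Equiv.swap (1 : Fin 4) 2) = ![a, c, b, d] := by
    funext i; fin_cases i <;> simp [Equiv.swap_apply_of_ne_of_ne]
  rw [← h, criticalCorr_comp_perm]

/-- Transposition `(2 3)` of the arguments of the critical four-point function. [folklore] -/
theorem criticalCorr_four_swap23 (a b c d : Site 3) :
    criticalCorr 3 4 ![a, b, d, c] = criticalCorr 3 4 ![a, b, c, d] := by
  have h : (![a, b, c, d] : Fin 4 → Site 3) ∘ ⇑(Equiv.swap (2 : Fin 4) 3) = ![a, b, d, c] := by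
    funext i; fin_cases i <;> simp [Equiv.swap_apply_of_ne_of_ne]
  rw [← h, criticalCorr_comp_perm]

/-- **Energy factorisation at `β_c` on `ℤ³`** (Aizenman's double-current representation of the
truncated four-point function, averaged over the two cross pairings): for all sites `a b x y`,
`⟨σ_aσ_bσ_xσ_y⟩ - ⟨σ_aσ_b⟩⟨σ_xσ_y⟩ =
  G(a,x)G(b,y)(1 - P^{{a}∆{x},{b}∆{y}}_{β_c}[a ↔ b]) + G(a,y)G(b,x)(1 - P^{{a}∆{y},{b}∆{x}}_{β_c}[a ↔ b])`.
[cite: AizenmanDuminilCopinAnnals2021, eq. (3.11)] -/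
theorem energyFactorisation_criticalCorr :
    ∀ a b x y : Site 3,
      criticalCorr 3 4 ![a, b, x, y] - criticalCorr 3 2 ![a, b] * criticalCorr 3 2 ![x, y] =
        criticalCorr 3 2 ![a, x] * criticalCorr 3 2 ![b, y] *
            (1 - (sourcedDoubleCurrentLawInf 3 (criticalBeta 3) ({a} ∆ {x}) ({b} ∆ {y})).real (openConn a b)) +
          criticalCorr 3 2 ![a, y] * criticalCorr 3 2 ![b, x] *
            (1 - (sourcedDoubleCurrentLawInf 3 (criticalBeta 3) ({a} ∆ {y}) ({b} ∆ {x})).real (openConn a b)) := by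
  intro a b x y
  have h1 := (freeUrsellFour_eq_sourcedDoubleCurrent_holds (d := 3)).criticalCorr_eq (by norm_num)
    a x b y
  have h2 := (freeUrsellFour_eq_sourcedDoubleCurrent_holds (d := 3)).criticalCorr_eq (by norm_num)
    a y b x
  rw [criticalCorr_four_swap12, criticalCorr_two_pair_comm x b] at h1
  rw [criticalCorr_four_swap12, criticalCorr_four_swap23, criticalCorr_two_pair_comm y x,
    criticalCorr_two_pair_comm y b] at h2
  linear_combination (h1 + h2) / 2

end Summit.CriticalPhenomena.Ising3DConformalLimit.EnergyNotSigmaSquaredGapForcesFarMerging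

end
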